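import Summits.HubbardSuperconductivity.HubbardSuperconductivity.Theorems.AnisotropyChordTransferFibre3N1Row
import Summits.HubbardSuperconductivity.HubbardSuperconductivity.Theorems.AnisotropyChordTransferFibre3TtailBounds
import Summits.HubbardSuperconductivity.HubbardSuperconductivity.Theorems.AnisotropyChordTransferFibre3OneLoopKit
import Summits.HubbardSuperconductivity.HubbardSuperconductivity.Theorems.AnisotropyChordTransferFibre3IMS
import Summits.HubbardSuperconductivity.HubbardSuperconductivity.Theorems.AnisotropyChordTransferFibre3TwoMagnonQF

/-!
# Route `AnisotropyChord` / H0 rotor rung: PartN41-B §2 closed-part moduli — `BlockCrossTerm`, `PhaseDefectSum`,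
`MuNormSq`, `MKIdentity`, `RKIdentity` PROVED

Theory-1 g22's PartN41-B §2 (ported …Fibre3N1Row): with `z = e^{−ik·e}` (`zPh = conj phase`), `β = c_s g + d/2`,
`μ_e(k) = −(1 − z)β + ½q(1 + z)`:
★ `blockCrossTerm_holds` (elementary complex perturbation bounds used per block momentum),
★ `phaseDefectSum_holds` (`Σ_e ‖1 − z‖² = 2E(k)`), ★ `muNormSq_holds` (`|μ_e|² = 2β²(1 − Re z) + ½q²(1 + Re z)`; the cross term
`Re[(1 − z̄)(1 + z)]` vanishes on `|z| = 1`), ★ `mKIdentity_holds` (`Σ_e |μ_e(k)|² = M(k) = 2β²E + ½q²(8 − E)`),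
★ `rKIdentity_holds` (`Σ_e Re(conj μ_e(k) μ_e(k′)) = R(k)`, via `Σ_e Re φ(K₁,e) = 4 − 2ε₁`).
Prover seat `hubbard-h0-rotor-p1` g26 (route lead); helper for stmt-HubbardSuperconductivity-23918 (`--supports`, helper class).
WHAT THIS IS NOT: nothing here proves superconductivity in the Hubbard model; closed-form bookkeeping of ONE row of ONE
conditional reduction.  Tree imports only; no new definitions; no sorry, no axioms.
-/

set_option linter.dupNamespace false
set_option autoImplicit false

noncomputable section

open scoped BigOperators

namespace Summit.HubbardSuperconductivity.HubbardSuperconductivity.Theorems.AnisotropyChord.Transfer.Fibre3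

variable (L : ℕ) [NeZero L]

namespace OuterMaj

/-! ## `BlockCrossTerm` -/

omit [NeZero L] in
/-- ★ `BlockCrossTerm` holds. [folklore] -/
theorem blockCrossTerm_holds : BlockCrossTerm := by
  intro x y m n P Q hx hy
  have hP : 0 ≤ P := (norm_nonneg _).trans hx
  have hQ : 0 ≤ Q := (norm_nonneg _).trans hy
  constructor
  · have e : (starRingEnd ℂ) x * y - (starRingEnd ℂ) m * n
        = (starRingEnd ℂ) m * (y - n) + (starRingEnd ℂ) (x - m) * n + (starRingEnd ℂ) (x - m) * (y - n) := by
      simp only [map_sub]; ring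
    rw [← Complex.sub_re, e]
    calc |(((starRingEnd ℂ) m * (y - n) + (starRingEnd ℂ) (x - m) * n + (starRingEnd ℂ) (x - m) * (y - n))).re|
        ≤ ‖(starRingEnd ℂ) m * (y - n) + (starRingEnd ℂ) (x - m) * n + (starRingEnd ℂ) (x - m) * (y - n)‖ :=
          Complex.abs_re_le_norm _
      _ ≤ ‖(starRingEnd ℂ) m * (y - n)‖ + ‖(starRingEnd ℂ) (x - m) * n‖ + ‖(starRingEnd ℂ) (x - m) * (y - n)‖ :=
          norm_add₃_le
      _ = ‖m‖ * ‖y - n‖ + ‖x - m‖ * ‖n‖ + ‖x - m‖ * ‖y - n‖ := by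
          simp only [norm_mul, Complex.norm_conj]
      _ ≤ ‖m‖ * Q + P * ‖n‖ + P * Q := by
          gcongr
      _ = ‖m‖ * Q + ‖n‖ * P + P * Q := by ring
  · rw [Complex.normSq_eq_norm_sq, Complex.normSq_eq_norm_sq]
    have h1 : |‖x‖ - ‖m‖| ≤ P := (abs_norm_sub_norm_le x m).trans hx
    have h2 : ‖x‖ ≤ ‖m‖ + P := by
      have := norm_le_norm_add_norm_sub' x m  -- ‖x‖ ≤ ‖m‖ + ‖x - m‖
      linarith
    have e : ‖x‖ ^ 2 - ‖m‖ ^ 2 = (‖x‖ - ‖m‖) * (‖x‖ + ‖m‖) := by ring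
    rw [e, abs_mul, abs_of_nonneg (by positivity : 0 ≤ ‖x‖ + ‖m‖)]
    calc |‖x‖ - ‖m‖| * (‖x‖ + ‖m‖) ≤ P * (‖m‖ + P + ‖m‖) := by
          apply mul_le_mul h1 (by linarith) (by positivity) hP
      _ = 2 * ‖m‖ * P + P ^ 2 := by ring

/-! ## Unit phases -/

/-- `re² + im² = 1` for a phase. [folklore] -/
theorem phase_re_sq_add_im_sq (k e : Tor L) : (phase L k e).re ^ 2 + (phase L k e).im ^ 2 = 1 := by
  have h := normSq_phase L k e
  rw [Complex.normSq_apply] at h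
  nlinarith [h]

/-- `‖1 − z̄‖² = 2(1 − Re z)` for a phase `z`. [folklore] -/
theorem normSq_one_sub_zPh (k e : Tor L) : Complex.normSq (1 - zPh L k e) = 2 * (1 - (phase L k e).re) := by
  have h := phase_re_sq_add_im_sq L k e
  unfold zPh
  rw [Complex.normSq_apply]
  simp only [Complex.sub_re, Complex.one_re, Complex.conj_re, Complex.sub_im, Complex.one_im, Complex.conj_im]
  nlinarith [h]

/-- the nearest-neighbour sum of `1 − Re e^{ik·e}` is `E(k) = 2ε_T(k)`. [folklore] -/
theorem nn_sum_one_sub_re (k : Tor L) :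
    (1 - (phase L k (ex L)).re) + (1 - (phase L k (-ex L)).re) + (1 - (phase L k (ey L)).re)
      + (1 - (phase L k (-ey L)).re) = EK L k := by
  unfold EK
  rw [phase_re_neg, phase_re_neg, epsT_eq_re]
  ring

/-- ★ `PhaseDefectSum L` holds: `Σ_{e ∈ nn} ‖1 − e^{−ik·e}‖² = 2E(k)`. [folklore] -/
theorem phaseDefectSum_holds : PhaseDefectSum L := by
  intro k
  rw [nnList_map_sum]
  simp only [normSq_one_sub_zPh]
  have := nn_sum_one_sub_re L k
  linarith

/-! ## `|μ_e(k)|²` and `M(k)` -/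

/-- ★ `MuNormSq L Δ` holds: `|μ_e(k)|² = 2β²(1 − Re z) + ½q²(1 + Re z)`. [folklore] -/
theorem muNormSq_holds (Δ : ℝ) : MuNormSq L Δ := by
  intro lam2 f e k
  have h := phase_re_sq_add_im_sq L k e
  unfold muK zPh
  rw [Complex.normSq_apply]
  simp only [Complex.add_re, Complex.add_im, Complex.neg_re, Complex.neg_im, Complex.mul_re, Complex.mul_im,
    Complex.sub_re, Complex.sub_im, Complex.one_re, Complex.one_im, Complex.conj_re, Complex.conj_im,
    Complex.ofReal_re, Complex.ofReal_im]
  set zr := (phase L k e).re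
  set zi := (phase L k e).im
  set β := betaK L Δ lam2 f k
  set q := qPar L Δ f
  linear_combination (β + q / 2) ^ 2 * h

/-- ★ `MKIdentity L Δ` holds: `Σ_{e ∈ nn} |μ_e(k)|² = M(k)`. [folklore] -/
theorem mKIdentity_holds (Δ : ℝ) : MKIdentity L Δ := by
  intro lam2 f k
  rw [nnList_map_sum]
  have hμ := muNormSq_holds L Δ lam2 f
  rw [hμ (ex L) k, hμ (-ex L) k, hμ (ey L) k, hμ (-ey L) k]
  have hE := nn_sum_one_sub_re L k
  unfold MK
  -- `Σ_e (1 − Re) = E`, `Σ_e (1 + Re) = 8 − E`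
  linear_combination (2 * betaK L Δ lam2 f k ^ 2 - qPar L Δ f ^ 2 / 2) * hE

/-! ## `R(k)`: `Σ_e Re(conj μ_e(k) μ_e(k′))` -/

omit [NeZero L] in
/-- the real part of `conj μ_e(k) · μ_e(k′)` in terms of `Re φ(k,e)`, `Re φ(k′,e)`, `Re(φ(k,e) conj φ(k′,e))`
(pure algebra, `β, q` real). [folklore] -/
theorem re_conj_muK_mul (Δ lam2 : ℝ) (f : Tor L → ℝ) (e k k' : Tor L) :
    ((starRingEnd ℂ) (muK L Δ lam2 f e k) * muK L Δ lam2 f e k').re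
      = betaK L Δ lam2 f k * betaK L Δ lam2 f k'
          * (1 - (phase L k e).re - (phase L k' e).re + (phase L k e * (starRingEnd ℂ) (phase L k' e)).re)
        - qPar L Δ f / 2 * betaK L Δ lam2 f k
          * (1 - (phase L k e).re + (phase L k' e).re - (phase L k e * (starRingEnd ℂ) (phase L k' e)).re)
        - qPar L Δ f / 2 * betaK L Δ lam2 f k'
          * (1 + (phase L k e).re - (phase L k' e).re - (phase L k e * (starRingEnd ℂ) (phase L k' e)).re)
        + qPar L Δ f ^ 2 / 4
          * (1 + (phase L k e).re + (phase L k' e).re + (phase L k e * (starRingEnd ℂ) (phase L k' e)).re) := by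
  unfold muK zPh
  simp only [map_add, map_neg, map_mul, map_sub, map_one, Complex.conj_conj, Complex.conj_ofReal,
    Complex.mul_re, Complex.mul_im, Complex.add_re, Complex.add_im, Complex.neg_re, Complex.neg_im,
    Complex.sub_re, Complex.sub_im, Complex.one_re, Complex.one_im, Complex.conj_re, Complex.conj_im,
    Complex.ofReal_re, Complex.ofReal_im]
  ring

/-- `Re(φ(k,e) conj φ(k + K₁, e)) = Re φ(K₁, e)`. [folklore] -/
theorem re_phase_mul_conj_shift (k e : Tor L) :
    (phase L k e * (starRingEnd ℂ) (phase L (k + K1 L) e)).re = (phase L (K1 L) e).re := by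
  rw [phase_add_left, map_mul, ← mul_assoc, Complex.mul_conj, Complex.mul_re, Complex.conj_re, Complex.conj_im]
  have h := normSq_phase L k e
  simp only [Complex.ofReal_re, Complex.ofReal_im, h]
  ring

/-- `Re φ(K₁, eₓ) = cos θ = 1 − ε₁` (all `L ≥ 1`). [folklore] -/
theorem phase_K1_ex_re : (phase L (K1 L) (ex L)).re = 1 - eps1 L := by
  rw [phase_ex_re]
  unfold eps1 K1
  simp only [ZMod.val_one_eq_one_mod]
  rcases Nat.lt_or_ge L 2 with hL | hL
  · have hL1 : L = 1 := by have := NeZero.ne L; omega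
    subst hL1
    simp
  · rw [Nat.one_mod_eq_one.2 (by omega)]
    push_cast; ring

/-- `Σ_e Re φ(K₁, e) = 4 − 2ε₁`. [folklore] -/
theorem nn_sum_phase_K1_re :
    (phase L (K1 L) (ex L)).re + (phase L (K1 L) (-ex L)).re + (phase L (K1 L) (ey L)).re
      + (phase L (K1 L) (-ey L)).re = 4 - 2 * eps1 L := by
  rw [phase_re_neg, phase_K1_ex_re, (phase_K1_ey L).1, (phase_K1_ey L).2, Complex.one_re]
  ring

/-- ★ `RKIdentity L Δ` holds: `Σ_{e ∈ nn} Re(conj μ_e(k) μ_e(k + K₁)) = R(k)`. [folklore] -/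
theorem rKIdentity_holds (Δ : ℝ) : RKIdentity L Δ := by
  intro lam2 f k
  rw [nnList_map_sum]
  simp only [re_conj_muK_mul, re_phase_mul_conj_shift]
  have hE := nn_sum_one_sub_re L k
  have hE' := nn_sum_one_sub_re L (k + K1 L)
  have hK := nn_sum_phase_K1_re L
  unfold RK
  linear_combination (betaK L Δ lam2 f k * betaK L Δ lam2 f (k + K1 L) - qPar L Δ f / 2 * betaK L Δ lam2 f k
      + qPar L Δ f / 2 * betaK L Δ lam2 f (k + K1 L) - qPar L Δ f ^ 2 / 4) * hE
    + (betaK L Δ lam2 f k * betaK L Δ lam2 f (k + K1 L) + qPar L Δ f / 2 * betaK L Δ lam2 f k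
      - qPar L Δ f / 2 * betaK L Δ lam2 f (k + K1 L) - qPar L Δ f ^ 2 / 4) * hE'
    + (betaK L Δ lam2 f k * betaK L Δ lam2 f (k + K1 L) + qPar L Δ f / 2 * betaK L Δ lam2 f k
      + qPar L Δ f / 2 * betaK L Δ lam2 f (k + K1 L) + qPar L Δ f ^ 2 / 4) * hK

end OuterMaj

end Summit.HubbardSuperconductivity.HubbardSuperconductivity.Theorems.AnisotropyChord.Transfer.Fibre3

end
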